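import Summits.BirchSwinnertonDyer.BirchSwinnertonDyer.Theorems.SylvesterTwoHeegnerIndexThmCKummerField
import Mathlib.NumberTheory.Cyclotomic.PrimitiveRoots
import HarnessLib

/-!
# Route `SylvesterTwoHeegnerIndex` (rung K7t), THEOREM C (item 19802): the HALVING `R = 2R′` and the
# `K`-LAYER handed over — THEOREM C from the CM-point core alone

HONEST FRAMING (cell b2b-bsdres, seat x1b GEN 52 = O12 class lead; file `--supports
stmt-BirchSwinnertonDyer-19802 --as helper`; THEOREM C stays OPEN). Sequel of `…ThmCKummerField.lean`
(the field / endomorphism layer of TRACE-LAWS_p made kernel). Two more structural layers of the CM-point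
laws are discharged here, def-free:

* §6 **the halving `R = 2R′`** (memo (C-b)+(C-c)+(C-d)₁: «`σ_{−1}` fixes `P₀`, so the trace of `φ(P₀)` over
  `Gal(H_{3p}/L_{(p)}) ∋ σ_{−1}` is twice a half-trace») as pure algebra: for a finite group `G`, an
  involution `s ≠ 1` and `f : G → M` with `f(gs) = f(g)`, `∑_g f(g) = 2•R′`
  (`exists_sum_eq_two_nsmul_of_involution`; action form `exists_trace_eq_two_nsmul_of_fixed`) — only
  `2•R′` enters TRACE-LAWS_p, so no transversal is needed downstream;
* §7 **the `K`-layer**: a quadratic number field `K ∋ ω` EXISTS (`ℚ(ζ₃)`, `exists_quadraticField_omega`),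
  and `rank_ℤ B(K) = 2` with a generator `P₀` of `B(ℚ)` mod torsion is part of the printed display
  `shaAnPair_mul_height_eq_two_zpow_mul_height`; so in **`hsyPointTwoDivisibleSevenModNine_of_cmPointCoreK`**
  the datum `(K, ω, rank, P₀, C)` is HANDED OVER to the CM-point provider together with the Kummer datum
  `(L, σ, c, [ω], φ)` of `exists_kummerCubicField` / `exists_rootMulEquiv` / `exists_twistMap`: what is asked
  is exactly the points `R′, t, T ∈ E₁(L)`, `Y ∈ B(K)` with Hu–Shu–Yin's trace law (Cor 2.5),
  `t ∈ {𝒪, (0, ±12√−3)}`, `3T = 0`, `Y_L = φ(2R′ − T)`, and the display for this `Y`.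

NET non-kernel content of THEOREM C after this file: the CM points themselves and their laws — ring class
fields / Shimura reciprocity (memo (C-a), (C-b)₁, (C-b)₂), [HuShuYin2019] Thm 2.3 (1) and Cor 2.5, and the
display for the explicit `Y` (Thm 4.4) — for which the tree has no carrier (`X₀(3⁵)` CM points).
NO definition, NO named fact, NO sorry; axioms standard; closes no item; nothing booked; no label moves.
References: [HuShuYin2019] pp. 7–8, 12; MEMO-bsd-cm-two v2.9 §15.5, §40.1; Mathlib `NumberTheory.Cyclotomic`.
-/

set_option autoImplicit false
-- the Summit-side namespace `Summit.BirchSwinnertonDyer.BirchSwinnertonDyer.…` (summit = problem) is mandated by D-0017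
set_option linter.dupNamespace false

noncomputable section

open scoped Classical

open Polynomial
open WeierstrassCurve WeierstrassCurve.Affine WeierstrassCurve.Affine.Point

namespace Summit.BirchSwinnertonDyer.BirchSwinnertonDyer.Theorems.SylvesterTwoThmCTwist

open SylvesterTwoCMNormForm SylvesterTwoThmCTorsion

/-! ## §6 The HALVING `R = 2R′`: a trace over a group containing an involution that fixes the point -/

section HalfTrace

/-- A sum of `F ∘ π` over a finite type all of whose `π`-fibres have exactly two elements is `2•` the sum
of `F` over the image of `π`. [folklore] -/
theorem sum_comp_eq_two_nsmul_of_card_fiber {ι κ M : Type*} [Fintype ι] [DecidableEq κ] [AddCommMonoid M]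
    (π : ι → κ) (F : κ → M) (h2 : ∀ i : ι, (Finset.univ.filter fun j : ι => π j = π i).card = 2) :
    ∑ i, F (π i) = (2 : ℕ) • ∑ q ∈ Finset.univ.image π, F q := by
  rw [Finset.sum_comp, Finset.smul_sum]
  refine Finset.sum_congr rfl fun q hq => ?_
  obtain ⟨i, -, rfl⟩ := Finset.mem_image.mp hq
  rw [h2 i]

variable {G M : Type*} [Group G] [Fintype G] [AddCommGroup M]

/-- **TRACE = 2 · HALF-TRACE.** For a finite group `G`, an involution `s ∈ G` (`s ≠ 1`, `s² = 1`) and any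
`f : G → M` into an abelian group with `f(g·s) = f(g)` for all `g`: `∑_g f(g) = 2•R′` for some `R′` (the sum
over a transversal of `G/⟨s⟩`: each coset `{g, gs}` contributes `2·f(g)`). For `G = Gal(H_{3p}/L_{(p)})`,
`s = σ_{−1}` fixing Hu–Shu–Yin's `φ(P₀)` and `f(g) = g·φ(P₀)` this is the cell's halving
`R = Tr φ(P₀) = 2R′` built into TRACE-LAWS_p (memo (C-b)+(C-c)+(C-d)₁); only `2•R′` enters the laws.
[cite: HuShuYin2019, p. 7] -/
theorem exists_sum_eq_two_nsmul_of_involution (f : G → M) {s : G} (hs1 : s ≠ 1) (hs2 : s * s = 1)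
    (hf : ∀ g : G, f (g * s) = f g) : ∃ R' : M, ∑ g, f g = (2 : ℕ) • R' := by
  classical
  have hinv : s⁻¹ = s := inv_eq_of_mul_eq_one_right hs2
  -- `⟨s⟩ = {1, s}` (`s` has order `2`)
  have hord : orderOf s = 2 := orderOf_eq_prime (by rw [pow_two, hs2]) hs1
  have hmem : ∀ x : G, x ∈ Subgroup.zpowers s → x = 1 ∨ x = s := by
    intro x hx
    rw [mem_zpowers_iff_mem_range_orderOf, hord, Finset.mem_image] at hx
    obtain ⟨k, hk, rfl⟩ := hx
    rw [Finset.mem_range] at hk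
    interval_cases k
    · exact Or.inl (pow_zero s)
    · exact Or.inr (pow_one s)
  -- `f` is constant on the left cosets of `⟨s⟩`
  have hconst : ∀ g g' : G, (g : G ⧸ Subgroup.zpowers s) = (g' : G ⧸ Subgroup.zpowers s) → f g' = f g := by
    intro g g' h
    rw [QuotientGroup.eq] at h
    rcases hmem _ h with h | h
    · rw [inv_mul_eq_one] at h
      rw [h]
    · have e : g' = g * s := by rw [← h, mul_inv_cancel_left]
      rw [e, hf]
  -- each fibre of `G → G/⟨s⟩` is a pair `{g₀, g₀ s}`
  have hcard : ∀ g₀ : G, (Finset.univ.filter fun g : G =>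
      (g : G ⧸ Subgroup.zpowers s) = (g₀ : G ⧸ Subgroup.zpowers s)).card = 2 := by
    intro g₀
    have hpair : (Finset.univ.filter fun g : G =>
        (g : G ⧸ Subgroup.zpowers s) = (g₀ : G ⧸ Subgroup.zpowers s)) = {g₀, g₀ * s} := by
      ext g
      simp only [Finset.mem_filter, Finset.mem_univ, true_and, Finset.mem_insert, Finset.mem_singleton]
      rw [QuotientGroup.eq]
      constructor
      · intro h
        rcases hmem _ h with h | h
        · left
          exact inv_mul_eq_one.mp h
        · right
          have e : g₀ = g * s := by rw [← h, mul_inv_cancel_left]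
          rw [e, mul_assoc, hs2, mul_one]
      · rintro (h | h)
        · rw [h, inv_mul_cancel]
          exact one_mem _
        · rw [h, mul_inv_rev, inv_mul_cancel_right, hinv]
          exact Subgroup.mem_zpowers s
    rw [hpair]
    refine Finset.card_pair fun h => hs1 ?_
    have e : g₀ * s = g₀ * 1 := by rw [mul_one]; exact h.symm
    exact mul_left_cancel e
  refine ⟨_, (Finset.sum_congr rfl fun g _ => hconst _ _ (QuotientGroup.out_eq' _)).trans
    (sum_comp_eq_two_nsmul_of_card_fiber (fun g : G => (g : G ⧸ Subgroup.zpowers s))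
      (fun q : G ⧸ Subgroup.zpowers s => f q.out) hcard)⟩

/-- **The halving for a GROUP ACTION**: if `G` acts on `M` (`ρ(gh) = ρ(g)ρ(h)`) and the involution `s`
FIXES `m`, then the trace `∑_g ρ(g)m` is `2•R′`. [cite: HuShuYin2019, p. 7] -/
theorem exists_trace_eq_two_nsmul_of_fixed (ρ : G → M → M) (hmul : ∀ g h x, ρ (g * h) x = ρ g (ρ h x))
    (m : M) {s : G} (hs1 : s ≠ 1) (hs2 : s * s = 1) (hsm : ρ s m = m) :
    ∃ R' : M, ∑ g, ρ g m = (2 : ℕ) • R' :=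
  exists_sum_eq_two_nsmul_of_involution (fun g => ρ g m) hs1 hs2 fun g => by
    show ρ (g * s) m = ρ g m
    rw [hmul, hsm]

end HalfTrace

/-! ## §7 THEOREM C from the CM-point core with the `K`-LAYER handed over as well -/

section CoreK

open Literature.NumberTheory.EllipticCurves Literature.NumberTheory.EllipticCurves.HuShuYin2019

/-- **A quadratic number field `K ∋ ω` EXISTS**: `K = ℚ(ζ₃)` (Mathlib's `CyclotomicField 3 ℚ`), `ω = ζ₃` a
root of the third cyclotomic polynomial `X² + X + 1`, `[K : ℚ] = φ(3) = 2`. [folklore] -/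
theorem exists_quadraticField_omega :
    ∃ (K : Type) (_ : Field K) (_ : NumberField K) (ω : K), ω ^ 2 + ω + 1 = 0 ∧ Module.finrank ℚ K = 2 := by
  -- the instance is supplied by hand: instance search meets the `Algebra ℚ _` diamond
  -- (`DivisionRing.toRatAlgebra` vs the splitting-field algebra) in this toolchain
  haveI : IsCyclotomicExtension {3} ℚ (CyclotomicField 3 ℚ) := CyclotomicField.isCyclotomicExtension 3 ℚ
  refine ⟨CyclotomicField 3 ℚ, inferInstance, inferInstance, IsCyclotomicExtension.zeta 3 ℚ (CyclotomicField 3 ℚ),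
    ?_, ?_⟩
  · have h := (Polynomial.isRoot_cyclotomic_iff_charZero three_pos).mpr
      (IsCyclotomicExtension.zeta_spec 3 ℚ (CyclotomicField 3 ℚ))
    rw [Polynomial.cyclotomic_three, Polynomial.IsRoot.def, eval_add, eval_add, eval_pow, eval_X,
      eval_one] at h
    exact h
  · rw [IsCyclotomicExtension.finrank (CyclotomicField 3 ℚ) (Polynomial.cyclotomic.irreducible_rat three_pos),
      Nat.totient_prime Nat.prime_three]

/-- **THEOREM C FROM THE CM-POINT CORE, `K`-LAYER HANDED OVER** (route decl). As
`hsyPointTwoDivisibleSevenModNine_of_cmPointCore`, but now ALSO the quadratic field `K ∋ ω`,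
`rank_ℤ B(K) = 2`, the generator `P₀` of `B(ℚ)` mod torsion and the model isomorphism `C` are HANDED OVER
(the kernel takes `K = ℚ(ζ₃)`, `exists_quadraticField_omega`; rank and generator from the printed display
`shaAnPair_mul_height_eq_two_zpow_mul_height`; `C` from the class binder): what is asked of the CM-point
provider is exactly — for every such datum and every Kummer datum `(L, σ, c, [ω], φ)` — points
`R′, t, T ∈ E₁(L)`, `Y ∈ B(K)` with Hu–Shu–Yin's trace law (Cor 2.5), `t ∈ {𝒪, (0, ±12√−3)}`, `3T = 0`,
`Y_L = φ(2R′ − T)` and the display `(qB·qA)·ĥ(P₀) = ¼·ĥ(Y)`, `qB·qA ≠ 0`. The item stays OPEN.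
[cite: HuShuYin2019, p. 7 (Cor. 2.5), pp. 8, 12] -/
theorem hsyPointTwoDivisibleSevenModNine_of_cmPointCoreK
    (hH : shaAnPair_mul_height_eq_two_zpow_mul_height)
    (hCoreK : ∀ (p : ℕ), p.Prime → p % 9 = 7 → (¬ ∃ x : ZMod p, x ^ 3 = 3) →
      ∀ (A B : WeierstrassCurve ℚ) [A.IsElliptic] [A.IsGloballyMinimal] [B.IsElliptic] [B.IsGloballyMinimal],
      (∃ C : VariableChange ℚ, C • B = cubeSumCurve (p : ℚ)) →
      (∃ C : VariableChange ℚ, C • A = cubeSumCurve (3 * (p : ℚ) ^ 2)) →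
      ∀ (qB qA : ℚ), shaAn B = (qB : ℂ) → shaAn A = (qA : ℂ) →
      ∀ (K : Type) [Field K] [NumberField K] (ω : K) (_ : ω ^ 2 + ω + 1 = 0) (_ : Module.finrank ℚ K = 2)
        (_ : (B.baseChange K).mordellWeilRank = 2)
        (P₀ : B.toAffine.Point) (_ : ¬ IsOfFinAddOrder (QuadraticDescent.incl K B P₀))
        (_ : ∀ Q : B.toAffine.Point, ∃ m : ℤ,
          IsOfFinAddOrder (QuadraticDescent.incl K B Q - m • QuadraticDescent.incl K B P₀))
        (C : VariableChange ℚ) (_ : C • B = cubeSumCurve (p : ℚ))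
        (hCK : (C • B).baseChange K = (cubeSumCurve (p : ℚ)).baseChange K)
        (L : Type) [Field L] [CharZero L] [Algebra K L] [IsGalois K L]
        (σ : L ≃ₐ[K] L) (_ : ∀ τ : L ≃ₐ[K] L, τ = 1 ∨ τ = σ ∨ τ = σ * σ)
        (c : L) (_ : c ^ 3 = ((p : ℚ) : L)) (_ : σ c = algebraMap K L ω * c)
        (θ : ((cubeSumCurve 1).baseChange L).toAffine.Point ≃+ ((cubeSumCurve 1).baseChange L).toAffine.Point)
        (_ : ∀ (x y : L) (h : ((cubeSumCurve 1).baseChange L).toAffine.Nonsingular x y),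
          ∃ h', θ (.some x y h) = .some (algebraMap K L ω * x) y h')
        (φ : ((cubeSumCurve 1).baseChange L).toAffine.Point ≃+
          ((cubeSumCurve (p : ℚ)).baseChange L).toAffine.Point)
        (_ : ∀ (x y : L) (h : ((cubeSumCurve 1).baseChange L).toAffine.Nonsingular x y),
          ∃ h', φ (.some x y h) = .some (c ^ 2 * x) (c ^ 3 * y) h'),
      ∃ (R' t T : ((cubeSumCurve 1).baseChange L).toAffine.Point) (Y : (B.baseChange K).toAffine.Point),
        Affine.Point.map (σ : L →ₐ[K] L) ((2 : ℕ) • R') = θ ((2 : ℕ) • R') + t ∧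
        (t = 0 ∨ (∃ h, t = .some 0 (12 * (2 * algebraMap K L ω + 1)) h) ∨
          (∃ h, t = .some 0 (-(12 * (2 * algebraMap K L ω + 1))) h)) ∧
        (3 : ℕ) • T = 0 ∧
        Affine.Point.map (algebraMap K L).toRatAlgHom
            (Affine.Point.congrEquiv hCK (VariableChange.pointEquivBaseChange B C K Y)) =
          φ ((2 : ℕ) • R' - T) ∧
        ((qB * qA : ℚ) : ℝ) * canonicalHeight (QuadraticDescent.incl K B P₀) =
          (2 : ℝ) ^ (-2 : ℤ) * canonicalHeight Y ∧ qB * qA ≠ 0) :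
    Summit.BirchSwinnertonDyer.BirchSwinnertonDyer.Theses.SylvesterTwoHeegnerIndex.HSYPointTwoDivisibleSevenModNine := by
  refine SylvesterTwoNonneg.hsyPointTwoDivisibleSevenModNine_of_heightDisplay_of_twoIntegral hH ?_
  intro p hp h7 h3 A B _ _ _ _ hB hA qB qA hqB hqA
  have hp2 : p ≠ 2 := by rintro rfl; norm_num at h7
  have hp0 : (p : ℚ) ≠ 0 := by exact_mod_cast hp.ne_zero
  -- the `K`-layer: `K = ℚ(ζ₃)`, rank and generator from the display fact, `C` from the class binder
  obtain ⟨K, _, _, ω, hω, h2K⟩ := exists_quadraticField_omega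
  obtain ⟨qB', qA', -, -, -, hrank, P₀, -, hP, hgenB, -⟩ := hH p hp (Or.inr h7) h3 A B hB hA K ω hω h2K
  obtain ⟨C, hC⟩ := hB
  have hCK : (C • B).baseChange K = (cubeSumCurve (p : ℚ)).baseChange K := by rw [hC]
  -- the Kummer datum
  obtain ⟨L, _, _, _, _, σ, hgen, c, hc, hσc, hcbrt⟩ := exists_kummerCubicField K h2K hω hp hp2
  have hωL := omega_algebraMap (L := L) hω
  obtain ⟨θ, hθ⟩ := exists_rootMulEquiv (W := (cubeSumCurve 1).baseChange L) (omega_pow_three hωL)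
    (cubeSumCurve_baseChange_a₁ 1) (cubeSumCurve_baseChange_a₂ 1) (cubeSumCurve_baseChange_a₃ 1)
    (cubeSumCurve_baseChange_a₄ 1)
  obtain ⟨φ, hφ⟩ := exists_twistMap (W := (cubeSumCurve 1).baseChange L)
    (W' := (cubeSumCurve (p : ℚ)).baseChange L) (cbrt_ne_zero hc hp0)
    (cubeSumCurve_baseChange_a₁ 1) (cubeSumCurve_baseChange_a₂ 1) (cubeSumCurve_baseChange_a₃ 1)
    (cubeSumCurve_baseChange_a₄ 1) (cubeSumCurve_baseChange_a₁ p) (cubeSumCurve_baseChange_a₂ p)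
    (cubeSumCurve_baseChange_a₃ p) (cubeSumCurve_baseChange_a₄ p) (cubeSumCurve_baseChange_a₆_twist hc)
  have hθ' : ∀ (x y : L) (h : ((cubeSumCurve 1).baseChange L).toAffine.Nonsingular x y),
      ∃ h', θ (.some x y h) = .some (algebraMap K L ω * x) y h' := fun x y h => ⟨_, hθ x y h⟩
  have hφ' : ∀ (x y : L) (h : ((cubeSumCurve 1).baseChange L).toAffine.Nonsingular x y),
      ∃ h', φ (.some x y h) = .some (c ^ 2 * x) (c ^ 3 * y) h' := fun x y h => ⟨_, hφ x y h⟩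
  -- the CM-point core for THIS datum, then the (C-d) assembly in trace form and two's reading
  obtain ⟨R', t, T, Y, hR, ht, hT, hY, hdisp, hq⟩ :=
    hCoreK p hp h7 h3 A B ⟨C, hC⟩ hA qB qA hqB hqA K ω hω h2K hrank P₀ hP hgenB C hC hCK L σ hgen c hc hσc
      θ hθ' φ hφ'
  have h2div := exists_eq_two_smul_add_torsion_of_cmPointLaws_trace hω hc hp0 B C hCK σ hgen hσc
    (_root_.map_zero θ) hθ (fun P Q => _root_.map_add θ P Q) (_root_.map_zero φ) hφ
    (fun P Q => _root_.map_add φ P Q) (cubeSumCurve_one_eq_zero_of_two_nsmul_eq_zero hcbrt) hR ht hT Y hY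
  have hle := SylvesterTwoNonneg.add_two_le_padicValRat_two_of_model_of_twoDivisible hω h2K hp hp2 B C hC
    hrank P₀ hP hgenB Y hq hdisp h2div
  linarith

end CoreK

end Summit.BirchSwinnertonDyer.BirchSwinnertonDyer.Theorems.SylvesterTwoThmCTwist

end
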